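import Literature.NumberTheory.LFunctions.KMVLogCutoffWBound
import Literature.NumberTheory.LFunctions.KMVCentralValueSquaredAFESeries
import Literature.NumberTheory.LFunctions.KMVCutoffWAfeWBridge
import HarnessLib

/-!
# KMV 2000 (21)–(22) at every order `k`: the series side in real form
# `Σ_{n₁,n₂} λ_f(n₁)λ_f(n₂)(n₁n₂)^{-1/2} W_{kk}(log q̂/n₁, log q̂/n₂; n₁n₂/q̂²) = 4π² ∫_0^∞ G_k(y) (∫_{v>1/(Ny)} G_k(v) dv) dy`,
# `G_k(y) = f(iy) (log(√N y))^k` (stub T4 of the fact skeleton `log-fricke-split`)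

Source: E. Kowalski, P. Michel, J. VanderKam, J. reine angew. Math. 526 (2000), (13) p. 9 and
(21)–(22) p. 12 [held: paper:doi-10-1515-crll-2000-074]. Cell landau-siegel / ls-inputs, line H-AFE2
(K-INPUTS-11 (1)), seat ls-inputs-Hafe-lead g1. Proofs only (no definitions, no named facts).

The argument is the order-`k` version of `KMV2000.hasSum_afeSqTerm` (`k = 0`): open the `q`-expansion
`f(iy) = Σ a_n e^{−2πny}` twice, once pointwise and once under the tail integral
(`hasSum_integral_Ioi_imagAxis_logWeight`), and substitute `x₁ = 2πn₁y`, `x₂ = 2πn₂v`: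
`log(q̂/n) + log(2πn y) = log(√N y)` (`q̂ = √N/2π`) and `v > 1/(Ny) ⟺ x₂ > (n₁n₂/q̂²)/x₁`, so that the
`(n₁,n₂)` term integrates to `a_{n₁}a_{n₂}/(4π²n₁n₂) · W_{kk}(log q̂/n₁, log q̂/n₂; n₁n₂/q̂²)`
(`W_{kk} = KMV2000.logCutoffW k k`). The exchange of sum and integral is dominated through Rankin's
bound (`KMVLogCutoffWBound`) with exponent `A = k + 3` and Hecke's bound `Σ ‖a_n‖ n^{-3} < ∞`
(`LSeriesSummable_cuspCoeff_gamma0` at `s = 3`).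

* `KMV2000.hasSum_logCutoffW_afe` — the statement for every `f ∈ S₂(Γ₀(N))`, `N ≥ 1`, every `k`;
* `KMV2000.hasSum_logCutoffW_all` — the registered quantifier shape of stub T4 (verbatim).

No claim about Landau–Siegel zeros.
-/

noncomputable section

open scoped Real
open Complex Set MeasureTheory Filter CongruenceSubgroup UpperHalfPlane
open Literature.NumberTheory.EllipticCurves.ModularForms

namespace Literature.NumberTheory.LFunctions.KMV2000

variable {N : ℕ} [NeZero N]

/-! ### Constants: `2π n (q̂/n) = √N`, `4π² n₁ n₂ / N = n₁n₂/q̂²` -/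

omit [NeZero N] in
/-- `2π · n · (q̂/n) = √N` (`q̂ = √N/2π`). [cite: KowalskiMichelVanderKam2000, §1 p. 1 (definition of q̂)] -/
theorem two_pi_mul_mul_qhat_div {n : ℕ} (hn : n ≠ 0) :
    2 * π * n * (qhat N / n) = Real.sqrt N := by
  have hn' : (n : ℝ) ≠ 0 := by exact_mod_cast hn
  rw [qhat]
  field_simp

/-- For `y > 0`, `n ≥ 1`: `log(q̂/n) + log(2πn y) = log(√N y)`. [cite: KowalskiMichelVanderKam2000, (21) p. 12] -/
theorem log_qhat_div_add_log {n : ℕ} (hn : n ≠ 0) {y : ℝ} (hy : 0 < y) :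
    Real.log (qhat N / n) + Real.log (2 * π * n * y) = Real.log (Real.sqrt N * y) := by
  have hn' : (0 : ℝ) < n := by exact_mod_cast Nat.pos_of_ne_zero hn
  have hq : 0 < qhat N / n := div_pos (qhat_pos_of_neZero N) hn'
  have h2 : 0 < 2 * π * n * y := by positivity
  rw [← Real.log_mul hq.ne' h2.ne']
  congr 1
  rw [show qhat N / n * (2 * π * n * y) = (2 * π * n * (qhat N / n)) * y by ring,
    two_pi_mul_mul_qhat_div hn]

/-- `4π² n₁ n₂ / N = n₁n₂/q̂²`. [cite: KowalskiMichelVanderKam2000, §1 p. 1 (definition of q̂)] -/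
theorem four_pi_sq_mul_div_eq (n₁ n₂ : ℕ) :
    4 * π ^ 2 * n₁ * n₂ / N = (n₁ : ℝ) * n₂ / qhat N ^ 2 := by
  have hN : (0 : ℝ) < N := by exact_mod_cast NeZero.pos N
  rw [qhat_sq]
  field_simp

/-! ### The `q`-expansion with the log weight, pointwise and under the tail integral -/

omit [NeZero N] in
/-- For `v > 0`: `Σ_n a_n e^{−2πnv} (log √N v)^k = f(iv) (log √N v)^k`. [cite: KowalskiMichelVanderKam2000, (13) p. 9] -/
theorem hasSum_imagAxis_logWeight (f : CuspForm (Gamma0 N) 2) (k : ℕ) {v : ℝ} (hv : 0 < v) :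
    HasSum (fun n : ℕ ↦ cuspCoeff f n * (Real.exp (-(2 * Real.pi * n) * v) : ℝ) *
        (((Real.log (Real.sqrt N * v)) ^ k : ℝ) : ℂ))
      (f (UpperHalfPlane.ofComplex (Complex.I * v)) * (((Real.log (Real.sqrt N * v)) ^ k : ℝ) : ℂ)) :=
  (hasSum_imagAxis one_mem_strictPeriods_Gamma0 f hv).mul_right _

/-- The weight `e^{−2πv}|log √N v|^k` is integrable on `(0,∞)` (substitute `x = 2πv`:
`log √N v = log q̂ + log x`). [cite: KowalskiMichelVanderKam2000, (21) p. 12] -/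
theorem integrableOn_exp_neg_two_pi_mul_abs_log_pow (k : ℕ) :
    IntegrableOn (fun v : ℝ ↦ Real.exp (-(2 * π * v)) * |Real.log (Real.sqrt N * v)| ^ k) (Ioi 0) := by
  have h1 := integrableOn_rpow_mul_expLogPow (qhat_pos_of_neZero N) k (σ := 0) (by norm_num)
  have h2 := (integrableOn_Ioi_comp_mul_left_iff
    (fun x : ℝ ↦ x ^ (0 : ℝ) * (Real.exp (-x) * |Real.log (qhat N) + Real.log x| ^ k)) 0
    Real.two_pi_pos).mpr (by rw [mul_zero]; exact h1)
  refine IntegrableOn.congr_fun h2 (fun v hv ↦ ?_) measurableSet_Ioi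
  have hv : (0 : ℝ) < v := hv
  have h1' : (1 : ℕ) ≠ 0 := one_ne_zero
  have hlog := log_qhat_div_add_log (N := N) h1' hv
  simp only [Nat.cast_one, div_one, mul_one] at hlog
  simp only [Real.rpow_zero, one_mul, ← hlog]

/-- **Tail of the weighted `q`-expansion, integrated termwise**: for `a > 0`,
`Σ_n a_n ∫_{v>a} e^{−2πnv}(log √N v)^k dv = ∫_{v>a} f(iv)(log √N v)^k dv` (dominated by
`Σ ‖a_n‖ e^{−2π(n−1)a} ∫_a^∞ e^{−2πv}|log √N v|^k < ∞`). [cite: KowalskiMichelVanderKam2000, (13) p. 9] -/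
theorem hasSum_integral_Ioi_imagAxis_logWeight (f : CuspForm (Gamma0 N) 2) (k : ℕ) {a : ℝ} (ha : 0 < a) :
    HasSum (fun n : ℕ ↦ cuspCoeff f n *
        ((∫ v in Ioi a, Real.exp (-(2 * Real.pi * n) * v) * (Real.log (Real.sqrt N * v)) ^ k : ℝ) : ℂ))
      (∫ v in Ioi a, f (UpperHalfPlane.ofComplex (Complex.I * v)) *
        (((Real.log (Real.sqrt N * v)) ^ k : ℝ) : ℂ)) := by
  have h0 : cuspCoeff f 0 = 0 := cuspCoeff_zero one_mem_strictPeriods_Gamma0 f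
  set w : ℝ → ℝ := fun v ↦ (Real.log (Real.sqrt N * v)) ^ k with hw
  -- the terms
  set F : ℕ → ℝ → ℂ := fun n v ↦ cuspCoeff f n *
    ((Real.exp (-(2 * Real.pi * n) * v) * w v : ℝ) : ℂ) with hF
  -- the majorant `K = ∫_{v>a} e^{−2πv}|w v|` and the pointwise bound for `n ≥ 1`
  have hKint : IntegrableOn (fun v : ℝ ↦ Real.exp (-(2 * π * v)) * |w v|) (Ioi a) := by
    refine IntegrableOn.congr_fun
      ((integrableOn_exp_neg_two_pi_mul_abs_log_pow (N := N) k).mono_set (Ioi_subset_Ioi ha.le))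
      (fun v _ ↦ ?_) measurableSet_Ioi
    simp only [hw, abs_pow]
  set K : ℝ := ∫ v in Ioi a, Real.exp (-(2 * π * v)) * |w v| with hK
  have hKnn : 0 ≤ K := setIntegral_nonneg measurableSet_Ioi fun v _ ↦ by positivity
  have hbound : ∀ n : ℕ, 1 ≤ n → ∀ v ∈ Ioi a,
      Real.exp (-(2 * Real.pi * n) * v) * |w v| ≤
        Real.exp (-(2 * π * (n - 1) * a)) * (Real.exp (-(2 * π * v)) * |w v|) := by
    intro n hn v hv
    have hv : a < v := hv
    have hn' : (1 : ℝ) ≤ n := by exact_mod_cast hn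
    rw [← mul_assoc, ← Real.exp_add]
    gcongr
    nlinarith [Real.pi_pos, mul_nonneg (sub_nonneg.mpr hn') (sub_nonneg.mpr hv.le)]
  have hcont_w : ContinuousOn w (Ioi 0) := by
    have hN : (0 : ℝ) < Real.sqrt N := Real.sqrt_pos.mpr (by exact_mod_cast NeZero.pos N)
    refine ContinuousOn.pow (Real.continuousOn_log.comp (by fun_prop) fun v hv ↦ ?_) k
    exact (mul_pos hN hv).ne'
  have hint_n : ∀ n : ℕ, 1 ≤ n →
      IntegrableOn (fun v : ℝ ↦ Real.exp (-(2 * Real.pi * n) * v) * w v) (Ioi a) := by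
    intro n hn
    have hmeas : AEStronglyMeasurable (fun v : ℝ ↦ Real.exp (-(2 * Real.pi * n) * v) * w v)
        (volume.restrict (Ioi a)) :=
      (ContinuousOn.mul (by fun_prop) (hcont_w.mono (Ioi_subset_Ioi ha.le))).aestronglyMeasurable
        measurableSet_Ioi
    refine Integrable.mono' (hKint.const_mul (Real.exp (-(2 * π * (n - 1) * a)))) hmeas ?_
    refine (ae_restrict_iff' measurableSet_Ioi).mpr (ae_of_all _ fun v hv ↦ ?_)
    rw [norm_mul, Real.norm_of_nonneg (Real.exp_pos _).le, Real.norm_eq_abs]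
    exact hbound n hn v hv
  have hF_int : ∀ n : ℕ, Integrable (F n) (volume.restrict (Ioi a)) := by
    intro n
    rcases Nat.eq_zero_or_pos n with rfl | hn
    · simp only [hF, h0, zero_mul]
      exact integrable_zero _ _ _
    · exact (hint_n n hn).ofReal.const_mul _
  -- `∫‖F n‖ ≤ ‖a_n‖ e^{-2πna} · (e^{2πa} K)`
  have hF_norm_le : ∀ n : ℕ, ∫ v in Ioi a, ‖F n v‖ ≤
      ‖cuspCoeff f n‖ * Real.exp (-(2 * π * n * a)) * (Real.exp (2 * π * a) * K) := by
    intro n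
    rcases Nat.eq_zero_or_pos n with rfl | hn
    · simp [hF, h0]
    · have hnorm : ∀ v : ℝ, ‖F n v‖ = ‖cuspCoeff f n‖ * (Real.exp (-(2 * Real.pi * n) * v) * |w v|) := by
        intro v
        simp only [hF, norm_mul, Complex.norm_real, Real.norm_eq_abs, abs_of_pos (Real.exp_pos _)]
      simp_rw [hnorm]
      have hI : ∫ v in Ioi a, Real.exp (-(2 * Real.pi * n) * v) * |w v| ≤
          Real.exp (-(2 * π * n * a)) * (Real.exp (2 * π * a) * K) := by
        calc ∫ v in Ioi a, Real.exp (-(2 * Real.pi * n) * v) * |w v|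
            ≤ ∫ v in Ioi a, Real.exp (-(2 * π * (n - 1) * a)) * (Real.exp (-(2 * π * v)) * |w v|) := by
              refine integral_mono_of_nonneg (ae_of_all _ fun v ↦ by positivity) (hKint.const_mul _) ?_
              exact (ae_restrict_iff' measurableSet_Ioi).mpr (ae_of_all _ fun v hv ↦ hbound n hn v hv)
          _ = Real.exp (-(2 * π * (n - 1) * a)) * K := integral_const_mul _ _
          _ = Real.exp (-(2 * π * n * a)) * (Real.exp (2 * π * a) * K) := by
              rw [← mul_assoc, ← Real.exp_add]; ring_nf
      rw [integral_const_mul]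
      calc ‖cuspCoeff f n‖ * ∫ v in Ioi a, Real.exp (-(2 * Real.pi * n) * v) * |w v|
          ≤ ‖cuspCoeff f n‖ * (Real.exp (-(2 * π * n * a)) * (Real.exp (2 * π * a) * K)) :=
            mul_le_mul_of_nonneg_left hI (norm_nonneg _)
        _ = _ := by ring
  have hsum : Summable fun n : ℕ ↦ ∫ v in Ioi a, ‖F n v‖ := by
    have hS := (summable_norm_cuspCoeff_mul_exp one_mem_strictPeriods_Gamma0 f ha).mul_right
      (Real.exp (2 * π * a) * K)
    refine hS.of_nonneg_of_le (fun n ↦ integral_nonneg fun v ↦ norm_nonneg _) fun n ↦ ?_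
    exact hF_norm_le n
  -- the value of each term
  have hF_val : ∀ n : ℕ, ∫ v in Ioi a, F n v = cuspCoeff f n *
      ((∫ v in Ioi a, Real.exp (-(2 * Real.pi * n) * v) * (Real.log (Real.sqrt N * v)) ^ k : ℝ) : ℂ) := by
    intro n
    simp only [hF]
    rw [integral_const_mul, integral_complex_ofReal]
  have hmain := hasSum_integral_of_summable_integral_norm hF_int hsum
  simp_rw [hF_val] at hmain
  have heq : ∫ v in Ioi a, (∑' n : ℕ, F n v) =
      ∫ v in Ioi a, f (UpperHalfPlane.ofComplex (Complex.I * v)) *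
        (((Real.log (Real.sqrt N * v)) ^ k : ℝ) : ℂ) := by
    refine setIntegral_congr_fun measurableSet_Ioi fun v hv ↦ ?_
    have hv0 : 0 < v := ha.trans hv
    have h := (hasSum_imagAxis_logWeight f k hv0).tsum_eq
    simp only [hF, hw]
    rw [← h]
    refine tsum_congr fun n ↦ ?_
    push_cast
    ring
  rwa [heq] at hmain

/-! ### Rankin's bound for the absolute tail (the inner integral with `|·|`) -/

/-- For `y > 0`, `x₁ > 0`, `A ≥ 0`: `∫_{x₂ > y/x₁} e^{−x₂}|a + log x₂|^j dx₂ ≤ (x₁/y)^A ∫_0^∞ x₂^A e^{−x₂}|a+log x₂|^j`.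
[cite: KowalskiMichelVanderKam2000, (22) p. 12] -/
theorem integral_abs_inner_tail_le (a : ℝ) (j : ℕ) {A y x₁ : ℝ} (hA : 0 ≤ A) (hy : 0 < y) (hx₁ : 0 < x₁) :
    ∫ x₂ in Ioi (y / x₁), Real.exp (-x₂) * |a + Real.log x₂| ^ j ≤
      (x₁ / y) ^ A * ∫ x₂ in Ioi (0 : ℝ), x₂ ^ A * (Real.exp (-x₂) * |a + Real.log x₂| ^ j) := by
  obtain ⟨hint, -⟩ := integral_rpow_exp_abs_log_pow_le a j hA
  have hyx : 0 < y / x₁ := div_pos hy hx₁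
  have hsub : Ioi (y / x₁) ⊆ Ioi (0 : ℝ) := Ioi_subset_Ioi hyx.le
  have hint' : IntegrableOn (fun x₂ : ℝ ↦ (x₁ / y) ^ A * (x₂ ^ A * (Real.exp (-x₂) * |a + Real.log x₂| ^ j)))
      (Ioi (y / x₁)) := (hint.mono_set hsub).const_mul _
  calc ∫ x₂ in Ioi (y / x₁), Real.exp (-x₂) * |a + Real.log x₂| ^ j
      ≤ ∫ x₂ in Ioi (y / x₁), (x₁ / y) ^ A * (x₂ ^ A * (Real.exp (-x₂) * |a + Real.log x₂| ^ j)) := by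
        refine integral_mono_of_nonneg (ae_of_all _ fun _ ↦ by positivity) hint' ?_
        refine (ae_restrict_iff' measurableSet_Ioi).mpr (ae_of_all _ fun x₂ hx₂ ↦ ?_)
        have hx₂ : y / x₁ < x₂ := hx₂
        have hx₂0 : 0 < x₂ := lt_trans hyx hx₂
        have hone : 1 ≤ (x₁ / y) ^ A * x₂ ^ A := by
          rw [← Real.mul_rpow (div_pos hx₁ hy).le hx₂0.le]
          refine Real.one_le_rpow ?_ hA
          rw [div_mul_eq_mul_div, le_div_iff₀ hy, one_mul]
          have := (div_lt_iff₀ hx₁).mp hx₂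
          linarith
        have hnn : 0 ≤ Real.exp (-x₂) * |a + Real.log x₂| ^ j := by positivity
        calc Real.exp (-x₂) * |a + Real.log x₂| ^ j = 1 * (Real.exp (-x₂) * |a + Real.log x₂| ^ j) := by ring
          _ ≤ ((x₁ / y) ^ A * x₂ ^ A) * (Real.exp (-x₂) * |a + Real.log x₂| ^ j) :=
              mul_le_mul_of_nonneg_right hone hnn
          _ = (x₁ / y) ^ A * (x₂ ^ A * (Real.exp (-x₂) * |a + Real.log x₂| ^ j)) := by ring
    _ ≤ ∫ x₂ in Ioi (0 : ℝ), (x₁ / y) ^ A * (x₂ ^ A * (Real.exp (-x₂) * |a + Real.log x₂| ^ j)) := by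
        refine setIntegral_mono_set (hint.const_mul _) ?_ (ae_of_all _ hsub)
        refine (ae_restrict_iff' measurableSet_Ioi).mpr (ae_of_all _ fun x₂ hx₂ ↦ ?_)
        have hx₂ : (0 : ℝ) < x₂ := hx₂
        have : 0 ≤ (x₁ / y) ^ A := Real.rpow_nonneg (div_pos hx₁ hy).le A
        positivity
    _ = (x₁ / y) ^ A * ∫ x₂ in Ioi (0 : ℝ), x₂ ^ A * (Real.exp (-x₂) * |a + Real.log x₂| ^ j) :=
        integral_const_mul _ _

/-! ### The substitutions `x = 2πn v` in the inner tail and `x₁ = 2πn₁ y` in the outer integral -/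

/-- Inner substitution: for `n ≥ 1`, `a > 0` and any `φ : ℝ → ℝ`,
`∫_{v>a} e^{−2πnv} φ(log √N v) dv = (2πn)⁻¹ ∫_{x > 2πn a} e^{−x} φ(log(q̂/n) + log x) dx`.
[cite: KowalskiMichelVanderKam2000, (21) p. 12] -/
theorem integral_Ioi_exp_comp_logWeight {n : ℕ} (hn : n ≠ 0) {a : ℝ} (ha : 0 < a) (φ : ℝ → ℝ) :
    ∫ v in Ioi a, Real.exp (-(2 * Real.pi * n) * v) * φ (Real.log (Real.sqrt N * v)) =
      (2 * π * n)⁻¹ * ∫ x in Ioi (2 * π * n * a), Real.exp (-x) * φ (Real.log (qhat N / n) + Real.log x) := by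
  have hb : 0 < 2 * π * (n : ℝ) := by positivity
  have hpt : ∀ v ∈ Ioi a, Real.exp (-(2 * Real.pi * n) * v) * φ (Real.log (Real.sqrt N * v)) =
      Real.exp (-(2 * π * n * v)) * φ (Real.log (qhat N / n) + Real.log (2 * π * n * v)) := by
    intro v hv
    have hv : 0 < v := ha.trans hv
    rw [log_qhat_div_add_log hn hv]
    ring_nf
  rw [setIntegral_congr_fun measurableSet_Ioi hpt]
  have h := integral_comp_mul_left_Ioi
    (fun x : ℝ ↦ Real.exp (-x) * φ (Real.log (qhat N / n) + Real.log x)) a hb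
  rw [h, smul_eq_mul]

/-- Outer substitution: for `n ≥ 1` and any `ψ Φ : ℝ → ℝ`,
`∫_{y>0} e^{−2πny} ψ(log √N y) Φ(y) dy = (2πn)⁻¹ ∫_{x>0} e^{−x} ψ(log(q̂/n)+log x) Φ(x/(2πn)) dx`.
[cite: KowalskiMichelVanderKam2000, (21) p. 12] -/
theorem integral_Ioi_exp_comp_logWeight_mul {n : ℕ} (hn : n ≠ 0) (ψ Φ : ℝ → ℝ) :
    ∫ y in Ioi (0 : ℝ), Real.exp (-(2 * Real.pi * n) * y) * ψ (Real.log (Real.sqrt N * y)) * Φ y =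
      (2 * π * n)⁻¹ * ∫ x in Ioi (0 : ℝ),
        Real.exp (-x) * ψ (Real.log (qhat N / n) + Real.log x) * Φ (x / (2 * π * n)) := by
  have hb : 0 < 2 * π * (n : ℝ) := by positivity
  have hpt : ∀ y ∈ Ioi (0 : ℝ), Real.exp (-(2 * Real.pi * n) * y) * ψ (Real.log (Real.sqrt N * y)) * Φ y =
      Real.exp (-(2 * π * n * y)) * ψ (Real.log (qhat N / n) + Real.log (2 * π * n * y)) *
        Φ (2 * π * n * y / (2 * π * n)) := by
    intro y hy
    have hy : (0 : ℝ) < y := hy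
    rw [log_qhat_div_add_log hn hy, show 2 * π * (n : ℝ) * y / (2 * π * n) = y by field_simp]
    ring_nf
  rw [setIntegral_congr_fun measurableSet_Ioi hpt]
  have h := integral_comp_mul_left_Ioi
    (fun x : ℝ ↦ Real.exp (-x) * ψ (Real.log (qhat N / n) + Real.log x) * Φ (x / (2 * π * n))) 0 hb
  rw [mul_zero] at h
  rw [h, smul_eq_mul]

/-! ### The main computation -/

/-- **The series side of KMV (21)–(22) at order `k`, in real form**: for every `f ∈ S₂(Γ₀(N))` and `k`,
`Σ_{(n₁,n₂)∈ℕ×ℕ} λ_f(n₁)λ_f(n₂)(n₁n₂)^{−1/2} W_{kk}(log q̂/n₁, log q̂/n₂; n₁n₂/q̂²)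
 = 4π² ∫_0^∞ f(iy)(log √N y)^k (∫_{v>1/(Ny)} f(iv)(log √N v)^k dv) dy` as a `HasSum`.
[cite: KowalskiMichelVanderKam2000, (21)–(22) p. 12] -/
theorem hasSum_logCutoffW_afe (f : CuspForm (Gamma0 N) 2) (k : ℕ) :
    HasSum (fun n : ℕ × ℕ ↦ GL2Family.heckeLambda f n.1 * GL2Family.heckeLambda f n.2 *
        ((((n.1 : ℝ) * n.2) ^ (-(1 / 2 : ℝ)) : ℝ) : ℂ) *
        ((logCutoffW k k (Real.log (qhat N / n.1)) (Real.log (qhat N / n.2))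
          ((n.1 : ℝ) * n.2 / qhat N ^ 2) : ℝ) : ℂ))
      (4 * (π : ℂ) ^ 2 *
        ∫ y in Ioi (0 : ℝ), (f (UpperHalfPlane.ofComplex (Complex.I * y)) *
            (((Real.log (Real.sqrt N * y)) ^ k : ℝ) : ℂ)) *
          ∫ v in Ioi (((N : ℝ) * y)⁻¹), f (UpperHalfPlane.ofComplex (Complex.I * v)) *
            (((Real.log (Real.sqrt N * v)) ^ k : ℝ) : ℂ)) := by
  have hN : (0 : ℝ) < N := by exact_mod_cast NeZero.pos N
  have h0 : cuspCoeff f 0 = 0 := cuspCoeff_zero one_mem_strictPeriods_Gamma0 f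
  have hq : 0 < qhat N := qhat_pos_of_neZero N
  -- notation
  set w : ℝ → ℝ := fun v ↦ (Real.log (Real.sqrt N * v)) ^ k with hw
  set Gf : ℝ → ℂ := fun v ↦ f (UpperHalfPlane.ofComplex (Complex.I * v)) * ((w v : ℝ) : ℂ) with hGf
  set E : ℕ → ℝ → ℝ := fun n x ↦ Real.exp (-x) * (Real.log (qhat N / n) + Real.log x) ^ k with hE
  set J : ℕ → ℝ → ℝ := fun n z ↦ ∫ x in Ioi z, E n x with hJ
  set A : ℕ → ℝ → ℂ := fun n y ↦ cuspCoeff f n * ((Real.exp (-(2 * Real.pi * n) * y) * w y : ℝ) : ℂ) with hA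
  set B : ℕ → ℝ → ℂ := fun n y ↦ cuspCoeff f n *
    ((∫ v in Ioi (((N : ℝ) * y)⁻¹), Real.exp (-(2 * Real.pi * n) * v) * w v : ℝ) : ℂ) with hB
  set T : ℕ × ℕ → ℝ → ℂ := fun p y ↦ A p.1 y * B p.2 y with hT
  -- vanishing on the axes
  have A_zero : A 0 = fun _ ↦ 0 := by funext y; simp [hA, h0]
  have B_zero : B 0 = fun _ ↦ 0 := by funext y; simp [hB, h0]
  have T_fst_zero : ∀ n₂ : ℕ, T (0, n₂) = fun _ ↦ 0 := by intro n₂; funext y; simp [hT, A_zero]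
  have T_snd_zero : ∀ n₁ : ℕ, T (n₁, 0) = fun _ ↦ 0 := by intro n₁; funext y; simp [hT, B_zero]
  -- the inner tail in substituted form: `B n y = a_n (2πn)⁻¹ J n (2πn/(Ny))`, `y > 0`, `n ≥ 1`
  have hcN : ∀ {y : ℝ}, 0 < y → 0 < ((N : ℝ) * y)⁻¹ := fun hy ↦ by positivity
  have B_eq : ∀ {n : ℕ}, n ≠ 0 → ∀ {y : ℝ}, 0 < y →
      B n y = cuspCoeff f n * (((2 * π * n)⁻¹ * J n (2 * π * n * ((N : ℝ) * y)⁻¹) : ℝ) : ℂ) := by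
    intro n hn y hy
    simp only [hB, hJ, hE, hw]
    rw [integral_Ioi_exp_comp_logWeight hn (hcN hy) (fun u ↦ u ^ k)]
  -- continuity of the substituted tail in `y`
  have J_cont : ∀ {n : ℕ}, n ≠ 0 → ContinuousOn (fun y : ℝ ↦ J n (2 * π * n * ((N : ℝ) * y)⁻¹)) (Ioi 0) := by
    intro n hn y hy
    have hy : (0 : ℝ) < y := hy
    have hc : 0 < qhat N / n := div_pos hq (by exact_mod_cast Nat.pos_of_ne_zero hn)
    have hz : 0 < 2 * π * n * ((N : ℝ) * y)⁻¹ := by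
      have : (0 : ℝ) < n := by exact_mod_cast Nat.pos_of_ne_zero hn
      positivity
    have h1 : ContinuousAt (fun y : ℝ ↦ 2 * π * n * ((N : ℝ) * y)⁻¹) y :=
      ContinuousAt.mul continuousAt_const ((continuousAt_const.mul continuousAt_id).inv₀
        (mul_ne_zero hN.ne' hy.ne'))
    exact (ContinuousAt.comp (g := fun z : ℝ ↦ ∫ x in Ioi z, E n x)
      (f := fun y : ℝ ↦ 2 * π * n * ((N : ℝ) * y)⁻¹) (continuousAt_tail hc k hz) h1).continuousWithinAt
  have w_cont : ContinuousOn w (Ioi 0) := by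
    have hs : (0 : ℝ) < Real.sqrt N := Real.sqrt_pos.mpr hN
    refine ContinuousOn.pow (Real.continuousOn_log.comp (by fun_prop) fun v hv ↦ ?_) k
    exact (mul_pos hs hv).ne'
  -- continuity of the terms on `(0, ∞)`
  have T_cont : ∀ p : ℕ × ℕ, p.1 ≠ 0 → p.2 ≠ 0 → ContinuousOn (T p) (Ioi 0) := by
    rintro ⟨n₁, n₂⟩ hn₁ hn₂
    have hA_cont : ContinuousOn (A n₁) (Ioi 0) := by
      refine continuousOn_const.mul (Complex.continuous_ofReal.comp_continuousOn ?_)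
      exact ContinuousOn.mul (by fun_prop) w_cont
    have hB_cont : ContinuousOn (B n₂) (Ioi 0) := by
      have h : ContinuousOn (fun y : ℝ ↦ cuspCoeff f n₂ *
          (((2 * π * n₂)⁻¹ * J n₂ (2 * π * n₂ * ((N : ℝ) * y)⁻¹) : ℝ) : ℂ)) (Ioi 0) :=
        continuousOn_const.mul (Complex.continuous_ofReal.comp_continuousOn
          (continuousOn_const.mul (J_cont hn₂)))
      exact h.congr fun y hy ↦ B_eq hn₂ hy
    exact hA_cont.mul hB_cont
  -- Rankin data: exponent `A = k + 3`, moments `M n = ∫ x^A e^{-x}|log(q̂/n)+log x|^k`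
  set Aexp : ℝ := ((k + 3 : ℕ) : ℝ) with hAexp
  have hAnn : 0 ≤ Aexp := by positivity
  set M : ℕ → ℝ := fun n ↦ ∫ x in Ioi (0 : ℝ), x ^ Aexp *
    (Real.exp (-x) * |Real.log (qhat N / n) + Real.log x| ^ k) with hM
  have hMnn : ∀ n, 0 ≤ M n := fun n ↦ setIntegral_nonneg measurableSet_Ioi fun x hx ↦ by
    have hx : (0 : ℝ) < x := hx; positivity
  set C : ℝ := ∫ x in Ioi (0 : ℝ), x ^ Aexp * (Real.exp (-x) * (2 ^ k * (1 + |Real.log x| ^ k))) with hC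
  have hMle : ∀ n, M n ≤ (1 + |Real.log (qhat N / n)|) ^ k * C := fun n ↦
    (integral_rpow_exp_abs_log_pow_le (Real.log (qhat N / n)) k hAnn).2
  have hCnn : 0 ≤ C := setIntegral_nonneg measurableSet_Ioi fun x hx ↦ by
    have hx : (0 : ℝ) < x := hx; positivity
  -- `y₀ = n₁n₂/q̂² = 4π²n₁n₂/N` and the identity `y₀/(x/(2πn₁))·… `: `2πn₂ (N (x/(2πn₁)))⁻¹ = y₀ / x`
  have harg : ∀ {n₁ n₂ : ℕ}, n₁ ≠ 0 → ∀ {x : ℝ}, 0 < x →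
      2 * π * n₂ * ((N : ℝ) * (x / (2 * π * n₁)))⁻¹ = ((n₁ : ℝ) * n₂ / qhat N ^ 2) / x := by
    intro n₁ n₂ hn₁ x hx
    have hn₁' : (n₁ : ℝ) ≠ 0 := by exact_mod_cast hn₁
    rw [← four_pi_sq_mul_div_eq]
    field_simp
    ring
  -- per-term integral: `∫ T p = a₁ a₂ (4π² n₁ n₂)⁻¹ W_{kk}(…; y₀)`
  have integral_T : ∀ {n₁ n₂ : ℕ}, n₁ ≠ 0 → n₂ ≠ 0 →
      ∫ y in Ioi (0 : ℝ), T (n₁, n₂) y = cuspCoeff f n₁ * cuspCoeff f n₂ *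
        (((2 * π * n₂)⁻¹ * (2 * π * n₁)⁻¹ *
          logCutoffW k k (Real.log (qhat N / n₁)) (Real.log (qhat N / n₂)) ((n₁ : ℝ) * n₂ / qhat N ^ 2) : ℝ) : ℂ) := by
    intro n₁ n₂ hn₁ hn₂
    have hpt : ∀ y ∈ Ioi (0 : ℝ), T (n₁, n₂) y = cuspCoeff f n₁ * cuspCoeff f n₂ *
        (((2 * π * n₂)⁻¹ * (Real.exp (-(2 * Real.pi * n₁) * y) * w y *
          J n₂ (2 * π * n₂ * ((N : ℝ) * y)⁻¹)) : ℝ) : ℂ) := by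
      intro y hy
      have hy : (0 : ℝ) < y := hy
      simp only [hT]
      rw [B_eq hn₂ hy]
      simp only [hA]
      push_cast
      ring
    rw [setIntegral_congr_fun measurableSet_Ioi hpt, integral_const_mul, integral_complex_ofReal,
      integral_const_mul]
    have hsub := integral_Ioi_exp_comp_logWeight_mul (N := N) hn₁ (fun u ↦ u ^ k)
      (fun y ↦ J n₂ (2 * π * n₂ * ((N : ℝ) * y)⁻¹))
    have hW : ∫ x in Ioi (0 : ℝ), Real.exp (-x) * (Real.log (qhat N / n₁) + Real.log x) ^ k *
        J n₂ (2 * π * n₂ * ((N : ℝ) * (x / (2 * π * n₁)))⁻¹) =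
        logCutoffW k k (Real.log (qhat N / n₁)) (Real.log (qhat N / n₂)) ((n₁ : ℝ) * n₂ / qhat N ^ 2) := by
      rw [logCutoffW]
      refine setIntegral_congr_fun measurableSet_Ioi fun x hx ↦ ?_
      simp only [hJ, hE]
      rw [harg hn₁ hx]
    have hreal : ∫ y in Ioi (0 : ℝ), Real.exp (-(2 * Real.pi * n₁) * y) * w y *
        J n₂ (2 * π * n₂ * ((N : ℝ) * y)⁻¹) =
        (2 * π * n₁)⁻¹ * logCutoffW k k (Real.log (qhat N / n₁)) (Real.log (qhat N / n₂))
          ((n₁ : ℝ) * n₂ / qhat N ^ 2) := by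
      simp only [hw]
      rw [hsub, hW]
    rw [hreal]
    push_cast
    ring
  -- per-term norm bound: `∫ ‖T p‖ ≤ ‖a₁‖‖a₂‖ (4π²n₁n₂)⁻¹ y₀^{-A} M n₁ M n₂`
  have norm_T : ∀ {n₁ n₂ : ℕ}, n₁ ≠ 0 → n₂ ≠ 0 → ∀ {y : ℝ}, 0 < y →
      ‖T (n₁, n₂) y‖ ≤ ‖cuspCoeff f n₁‖ * ‖cuspCoeff f n₂‖ * ((2 * π * n₂)⁻¹ * M n₂ *
        (Real.exp (-(2 * Real.pi * n₁) * y) * |Real.log (Real.sqrt N * y)| ^ k *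
          (2 * π * n₁ * y / ((n₁ : ℝ) * n₂ / qhat N ^ 2)) ^ Aexp)) := by
    intro n₁ n₂ hn₁ hn₂ y hy
    have hn₁' : (0 : ℝ) < n₁ := by exact_mod_cast Nat.pos_of_ne_zero hn₁
    have hn₂' : (0 : ℝ) < n₂ := by exact_mod_cast Nat.pos_of_ne_zero hn₂
    have hy₀ : 0 < (n₁ : ℝ) * n₂ / qhat N ^ 2 := by positivity
    have hx₁ : 0 < 2 * π * n₁ * y := by positivity
    -- the inner tail with absolute values and Rankin
    have hinner : |J n₂ (2 * π * n₂ * ((N : ℝ) * y)⁻¹)| ≤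
        (2 * π * n₁ * y / ((n₁ : ℝ) * n₂ / qhat N ^ 2)) ^ Aexp * M n₂ := by
      have heq : 2 * π * n₂ * ((N : ℝ) * y)⁻¹ = ((n₁ : ℝ) * n₂ / qhat N ^ 2) / (2 * π * n₁ * y) := by
        have h := harg (n₂ := n₂) hn₁ hx₁
        rw [← h]
        congr 2
        field_simp
      rw [heq]
      simp only [hJ, hE]
      calc |∫ x in Ioi (((n₁ : ℝ) * n₂ / qhat N ^ 2) / (2 * π * n₁ * y)),
              Real.exp (-x) * (Real.log (qhat N / n₂) + Real.log x) ^ k|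
          ≤ ∫ x in Ioi (((n₁ : ℝ) * n₂ / qhat N ^ 2) / (2 * π * n₁ * y)),
              |Real.exp (-x) * (Real.log (qhat N / n₂) + Real.log x) ^ k| := by
            rw [← Real.norm_eq_abs]
            exact (norm_integral_le_integral_norm _).trans (le_of_eq rfl)
        _ = ∫ x in Ioi (((n₁ : ℝ) * n₂ / qhat N ^ 2) / (2 * π * n₁ * y)),
              Real.exp (-x) * |Real.log (qhat N / n₂) + Real.log x| ^ k := by
            refine setIntegral_congr_fun measurableSet_Ioi fun x _ ↦ ?_
            rw [abs_mul, abs_of_pos (Real.exp_pos _), abs_pow]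
        _ ≤ _ := integral_abs_inner_tail_le (Real.log (qhat N / n₂)) k hAnn hy₀ hx₁
    simp only [hT, hA]
    rw [B_eq hn₂ hy, norm_mul, norm_mul, norm_mul, Complex.norm_real, Complex.norm_real,
      Real.norm_eq_abs, Real.norm_eq_abs, abs_mul, abs_mul, abs_of_pos (Real.exp_pos _),
      abs_of_pos (by positivity : (0 : ℝ) < (2 * π * n₂)⁻¹)]
    simp only [hw, abs_pow]
    have e1 : 0 ≤ Real.exp (-(2 * Real.pi * n₁) * y) * |Real.log (Real.sqrt N * y)| ^ k := by positivity
    calc ‖cuspCoeff f n₁‖ * (Real.exp (-(2 * Real.pi * n₁) * y) * |Real.log (Real.sqrt N * y)| ^ k) *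
          (‖cuspCoeff f n₂‖ * ((2 * π * n₂)⁻¹ * |J n₂ (2 * π * n₂ * ((N : ℝ) * y)⁻¹)|))
        ≤ ‖cuspCoeff f n₁‖ * (Real.exp (-(2 * Real.pi * n₁) * y) * |Real.log (Real.sqrt N * y)| ^ k) *
          (‖cuspCoeff f n₂‖ * ((2 * π * n₂)⁻¹ *
            ((2 * π * n₁ * y / ((n₁ : ℝ) * n₂ / qhat N ^ 2)) ^ Aexp * M n₂))) := by gcongr
      _ = _ := by ring
  -- the dominator of `T p` integrates to `‖a₁‖‖a₂‖ (4π²n₁n₂)⁻¹ y₀^{-A} M n₁ M n₂`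
  have integral_dom : ∀ {n₁ n₂ : ℕ}, n₁ ≠ 0 → n₂ ≠ 0 →
      IntegrableOn (fun y : ℝ ↦ Real.exp (-(2 * Real.pi * n₁) * y) * |Real.log (Real.sqrt N * y)| ^ k *
          (2 * π * n₁ * y / ((n₁ : ℝ) * n₂ / qhat N ^ 2)) ^ Aexp) (Ioi 0) ∧
      ∫ y in Ioi (0 : ℝ), Real.exp (-(2 * Real.pi * n₁) * y) * |Real.log (Real.sqrt N * y)| ^ k *
          (2 * π * n₁ * y / ((n₁ : ℝ) * n₂ / qhat N ^ 2)) ^ Aexp =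
        (2 * π * n₁)⁻¹ * ((((n₁ : ℝ) * n₂ / qhat N ^ 2) ^ Aexp)⁻¹ * M n₁) := by
    intro n₁ n₂ hn₁ hn₂
    have hn₁' : (0 : ℝ) < n₁ := by exact_mod_cast Nat.pos_of_ne_zero hn₁
    have hn₂' : (0 : ℝ) < n₂ := by exact_mod_cast Nat.pos_of_ne_zero hn₂
    have hy₀ : 0 < (n₁ : ℝ) * n₂ / qhat N ^ 2 := by positivity
    set y₀ : ℝ := (n₁ : ℝ) * n₂ / qhat N ^ 2 with hy₀_def
    have hb : 0 < 2 * π * (n₁ : ℝ) := by positivity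
    -- the substituted integrand `g(x) = e^{-x}|a₁+log x|^k (x/y₀)^A = y₀^{-A} · x^A e^{-x}|…|^k`
    obtain ⟨hgint, -⟩ := integral_rpow_exp_abs_log_pow_le (Real.log (qhat N / n₁)) k hAnn
    have hg : IntegrableOn (fun x : ℝ ↦ Real.exp (-x) * |Real.log (qhat N / n₁) + Real.log x| ^ k *
        (x / y₀) ^ Aexp) (Ioi 0) := by
      refine IntegrableOn.congr_fun (hgint.const_mul ((y₀ ^ Aexp)⁻¹)) (fun x hx ↦ ?_) measurableSet_Ioi
      have hx : (0 : ℝ) < x := hx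
      rw [Real.div_rpow hx.le hy₀.le]
      ring
    have hpt : ∀ y ∈ Ioi (0 : ℝ), Real.exp (-(2 * Real.pi * n₁) * y) * |Real.log (Real.sqrt N * y)| ^ k *
        (2 * π * n₁ * y / y₀) ^ Aexp =
        (fun x : ℝ ↦ Real.exp (-x) * |Real.log (qhat N / n₁) + Real.log x| ^ k * (x / y₀) ^ Aexp)
          (2 * π * n₁ * y) := by
      intro y hy
      have hy : (0 : ℝ) < y := hy
      simp only
      rw [log_qhat_div_add_log hn₁ hy]
      ring_nf
    constructor
    · have h2 := (integrableOn_Ioi_comp_mul_left_iff (fun x : ℝ ↦ Real.exp (-x) *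
        |Real.log (qhat N / n₁) + Real.log x| ^ k * (x / y₀) ^ Aexp) 0 hb).mpr (by rw [mul_zero]; exact hg)
      exact IntegrableOn.congr_fun h2 (fun y hy ↦ (hpt y hy).symm) measurableSet_Ioi
    · rw [integral_Ioi_exp_comp_logWeight_mul (N := N) hn₁ (fun u ↦ |u| ^ k) (fun y ↦ (2 * π * n₁ * y / y₀) ^ Aexp)]
      congr 1
      simp only [hM]
      rw [← integral_const_mul]
      refine setIntegral_congr_fun measurableSet_Ioi fun x hx ↦ ?_
      have hx : (0 : ℝ) < x := hx
      have hxx : 2 * π * (n₁ : ℝ) * (x / (2 * π * n₁)) = x := by field_simp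
      rw [hxx, Real.div_rpow hx.le hy₀.le]
      ring
  -- each term is integrable on `(0, ∞)`
  have integrableOn_T : ∀ p : ℕ × ℕ, IntegrableOn (T p) (Ioi 0) := by
    rintro ⟨n₁, n₂⟩
    rcases Nat.eq_zero_or_pos n₁ with rfl | h₁
    · rw [T_fst_zero]; exact integrableOn_zero
    rcases Nat.eq_zero_or_pos n₂ with rfl | h₂
    · rw [T_snd_zero]; exact integrableOn_zero
    obtain ⟨hdom, -⟩ := integral_dom h₁.ne' h₂.ne'
    refine Integrable.mono' (hdom.const_mul (‖cuspCoeff f n₁‖ * ‖cuspCoeff f n₂‖ * ((2 * π * n₂)⁻¹ * M n₂)))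
      ((T_cont (n₁, n₂) h₁.ne' h₂.ne').aestronglyMeasurable measurableSet_Ioi) ?_
    refine (ae_restrict_iff' measurableSet_Ioi).mpr (ae_of_all _ fun y hy ↦ ?_)
    have h := norm_T h₁.ne' h₂.ne' (y := y) hy
    calc ‖T (n₁, n₂) y‖ ≤ _ := h
      _ = _ := by ring
  -- bound on the `L¹` norms
  have norm_integral_T : ∀ {n₁ n₂ : ℕ}, n₁ ≠ 0 → n₂ ≠ 0 →
      ∫ y in Ioi (0 : ℝ), ‖T (n₁, n₂) y‖ ≤ ‖cuspCoeff f n₁‖ * ‖cuspCoeff f n₂‖ *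
        ((2 * π * n₂)⁻¹ * (2 * π * n₁)⁻¹ * ((((n₁ : ℝ) * n₂ / qhat N ^ 2) ^ Aexp)⁻¹ * (M n₁ * M n₂))) := by
    intro n₁ n₂ hn₁ hn₂
    obtain ⟨hdom, hval⟩ := integral_dom hn₁ hn₂
    calc ∫ y in Ioi (0 : ℝ), ‖T (n₁, n₂) y‖
        ≤ ∫ y in Ioi (0 : ℝ), ‖cuspCoeff f n₁‖ * ‖cuspCoeff f n₂‖ * ((2 * π * n₂)⁻¹ * M n₂) *
            (Real.exp (-(2 * Real.pi * n₁) * y) * |Real.log (Real.sqrt N * y)| ^ k *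
              (2 * π * n₁ * y / ((n₁ : ℝ) * n₂ / qhat N ^ 2)) ^ Aexp) := by
          refine integral_mono_of_nonneg (ae_of_all _ fun y ↦ norm_nonneg _) (hdom.const_mul _) ?_
          exact (ae_restrict_iff' measurableSet_Ioi).mpr
            (ae_of_all _ fun y hy ↦ (norm_T hn₁ hn₂ hy).trans_eq (by ring))
      _ = ‖cuspCoeff f n₁‖ * ‖cuspCoeff f n₂‖ * ((2 * π * n₂)⁻¹ * M n₂) *
            ∫ y in Ioi (0 : ℝ), Real.exp (-(2 * Real.pi * n₁) * y) * |Real.log (Real.sqrt N * y)| ^ k *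
              (2 * π * n₁ * y / ((n₁ : ℝ) * n₂ / qhat N ^ 2)) ^ Aexp := integral_const_mul _ _
      _ = _ := by rw [hval]; ring
  -- the arithmetic of the exponents: `(q̂²/(n₁n₂))^{k+3} (L n₁)^k (L n₂)^k / (n₁ n₂) ≤ q̂^{2k+6} L^{2k} /(n₁³ n₂³)`
  set L : ℝ := 1 + |Real.log (qhat N)| with hL
  have hL1 : 1 ≤ L := by have := abs_nonneg (Real.log (qhat N)); linarith
  have hlogle : ∀ {n : ℕ}, n ≠ 0 → 1 + |Real.log (qhat N / n)| ≤ L * n := by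
    intro n hn
    have hn' : (1 : ℝ) ≤ n := by exact_mod_cast Nat.one_le_iff_ne_zero.mpr hn
    have hn0 : (0 : ℝ) < n := by linarith
    have hlogn : 0 ≤ Real.log n := Real.log_nonneg hn'
    have hlogn' : Real.log n ≤ n - 1 := Real.log_le_sub_one_of_pos hn0
    rw [Real.log_div hq.ne' hn0.ne']
    calc 1 + |Real.log (qhat N) - Real.log n| ≤ 1 + (|Real.log (qhat N)| + Real.log n) := by
          have := abs_sub (Real.log (qhat N)) (Real.log n)
          rw [abs_of_nonneg hlogn] at this
          linarith
      _ ≤ (1 + |Real.log (qhat N)|) * (1 + Real.log n) := by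
          nlinarith [abs_nonneg (Real.log (qhat N))]
      _ ≤ L * n := by rw [hL]; gcongr; linarith
  have hMle' : ∀ {n : ℕ}, n ≠ 0 → M n ≤ (L * n) ^ k * C := fun {n} hn ↦
    (hMle n).trans (mul_le_mul_of_nonneg_right (pow_le_pow_left₀ (by positivity) (hlogle hn) k) hCnn)
  -- summability of the norms against `b n = ‖a_n‖/n³`
  have summable_norm_T : Summable fun p : ℕ × ℕ ↦ ∫ y in Ioi (0 : ℝ), ‖T p y‖ := by
    set b : ℕ → ℝ := fun n ↦ ‖LSeries.term (cuspCoeff f) 3 n‖ with hb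
    have hbs : Summable b := (LSeriesSummable_cuspCoeff_gamma0 f (s := 3) (by norm_num)).norm
    have hb_eq : ∀ n : ℕ, n ≠ 0 → b n = ‖cuspCoeff f n‖ / (n : ℝ) ^ 3 := by
      intro n hn
      simp only [hb, LSeries.norm_term_eq, hn, if_false]
      norm_num
    have hb0 : b 0 = 0 := by simp [hb, LSeries.norm_term_eq]
    have hprod : Summable fun p : ℕ × ℕ ↦ b p.1 * b p.2 :=
      summable_mul_of_summable_norm (f := b) (g := b)
        (hbs.norm.congr fun n ↦ by simp) (hbs.norm.congr fun n ↦ by simp)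
    set Kc : ℝ := (2 * π)⁻¹ * (2 * π)⁻¹ * ((qhat N ^ 2) ^ Aexp * (C * C * (L ^ k * L ^ k))) with hKc
    refine (hprod.mul_left Kc).of_nonneg_of_le (fun p ↦ integral_nonneg fun y ↦ norm_nonneg _) fun p ↦ ?_
    obtain ⟨n₁, n₂⟩ := p
    rcases Nat.eq_zero_or_pos n₁ with rfl | h₁
    · simp only [T_fst_zero, norm_zero, integral_zero, hb0, zero_mul, mul_zero]; exact le_refl _
    rcases Nat.eq_zero_or_pos n₂ with rfl | h₂
    · simp only [T_snd_zero, norm_zero, integral_zero, hb0, mul_zero]; exact le_refl _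
    have hn₁ : (0 : ℝ) < n₁ := by exact_mod_cast h₁
    have hn₂ : (0 : ℝ) < n₂ := by exact_mod_cast h₂
    have hn₁1 : (1 : ℝ) ≤ n₁ := by exact_mod_cast h₁
    have hn₂1 : (1 : ℝ) ≤ n₂ := by exact_mod_cast h₂
    simp only
    rw [hb_eq n₁ h₁.ne', hb_eq n₂ h₂.ne']
    refine (norm_integral_T h₁.ne' h₂.ne').trans ?_
    -- `(y₀^A)⁻¹ = (q̂²)^A / (n₁ n₂)^A` and `(n₁n₂)^A = (n₁n₂)^(k+3)`
    have hy₀A : (((n₁ : ℝ) * n₂ / qhat N ^ 2) ^ Aexp)⁻¹ = (qhat N ^ 2) ^ Aexp / ((n₁ : ℝ) * n₂) ^ (k + 3) := by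
      rw [Real.div_rpow (by positivity) (by positivity), inv_div, hAexp, Real.rpow_natCast ((n₁ : ℝ) * n₂)]
    rw [hy₀A]
    have hM₁ := hMle' h₁.ne'
    have hM₂ := hMle' h₂.ne'
    have hMM : M n₁ * M n₂ ≤ (L * n₁) ^ k * C * ((L * n₂) ^ k * C) :=
      mul_le_mul hM₁ hM₂ (hMnn _) (by positivity)
    have hqA : 0 ≤ (qhat N ^ 2) ^ Aexp := by positivity
    calc ‖cuspCoeff f n₁‖ * ‖cuspCoeff f n₂‖ * ((2 * π * n₂)⁻¹ * (2 * π * n₁)⁻¹ *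
          ((qhat N ^ 2) ^ Aexp / ((n₁ : ℝ) * n₂) ^ (k + 3) * (M n₁ * M n₂)))
        ≤ ‖cuspCoeff f n₁‖ * ‖cuspCoeff f n₂‖ * ((2 * π * n₂)⁻¹ * (2 * π * n₁)⁻¹ *
          ((qhat N ^ 2) ^ Aexp / ((n₁ : ℝ) * n₂) ^ (k + 3) * ((L * n₁) ^ k * C * ((L * n₂) ^ k * C)))) := by
          gcongr
      _ = Kc * (‖cuspCoeff f n₁‖ / (n₁ : ℝ) ^ 3 * (‖cuspCoeff f n₂‖ / (n₂ : ℝ) ^ 3)) *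
          ((n₁ : ℝ)⁻¹ * (n₂ : ℝ)⁻¹) := by
          rw [hKc]
          field_simp
          ring
      _ ≤ Kc * (‖cuspCoeff f n₁‖ / (n₁ : ℝ) ^ 3 * (‖cuspCoeff f n₂‖ / (n₂ : ℝ) ^ 3)) * 1 := by
          have hK0 : 0 ≤ Kc * (‖cuspCoeff f n₁‖ / (n₁ : ℝ) ^ 3 * (‖cuspCoeff f n₂‖ / (n₂ : ℝ) ^ 3)) := by
            positivity
          refine mul_le_mul_of_nonneg_left ?_ hK0
          rw [← mul_inv]
          exact inv_le_one_of_one_le₀ (by nlinarith)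
      _ = _ := by ring
  -- pointwise: for `y > 0` the double series sums to `G(y) · ∫_{v > 1/(Ny)} G(v) dv`
  have hasSum_T : ∀ {y : ℝ}, 0 < y → HasSum (fun p : ℕ × ℕ ↦ T p y)
      (Gf y * ∫ v in Ioi (((N : ℝ) * y)⁻¹), Gf v) := by
    intro y hy
    have hA' := hasSum_imagAxis_logWeight f k hy
    have hB' := hasSum_integral_Ioi_imagAxis_logWeight f k (hcN hy)
    have hAn := summable_norm_iff.mpr hA'.summable
    have hBn := summable_norm_iff.mpr hB'.summable
    have hfun : (fun p : ℕ × ℕ ↦ T p y) = fun p : ℕ × ℕ ↦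
        (cuspCoeff f p.1 * (Real.exp (-(2 * Real.pi * p.1) * y) : ℝ) *
          (((Real.log (Real.sqrt N * y)) ^ k : ℝ) : ℂ)) *
        (cuspCoeff f p.2 * ((∫ v in Ioi (((N : ℝ) * y)⁻¹), Real.exp (-(2 * Real.pi * p.2) * v) *
          (Real.log (Real.sqrt N * v)) ^ k : ℝ) : ℂ)) := by
      funext p
      simp only [hT, hA, hB, hw]
      push_cast
      ring
    have hval : Gf y * ∫ v in Ioi (((N : ℝ) * y)⁻¹), Gf v =
        (f (UpperHalfPlane.ofComplex (Complex.I * y)) * (((Real.log (Real.sqrt N * y)) ^ k : ℝ) : ℂ)) *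
          ∫ v in Ioi (((N : ℝ) * y)⁻¹), f (UpperHalfPlane.ofComplex (Complex.I * v)) *
            (((Real.log (Real.sqrt N * v)) ^ k : ℝ) : ℂ) := by
      simp only [hGf, hw]
    have hprod := summable_mul_of_summable_norm
      (f := fun n : ℕ ↦ cuspCoeff f n * (Real.exp (-(2 * Real.pi * n) * y) : ℝ) *
        (((Real.log (Real.sqrt N * y)) ^ k : ℝ) : ℂ))
      (g := fun n : ℕ ↦ cuspCoeff f n * ((∫ v in Ioi (((N : ℝ) * y)⁻¹), Real.exp (-(2 * Real.pi * n) * v) *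
        (Real.log (Real.sqrt N * v)) ^ k : ℝ) : ℂ)) hAn hBn
    have h := hA'.mul hB' hprod
    rw [hfun, hval]
    exact h
  -- exchange sum and integral
  have hmain := hasSum_integral_of_summable_integral_norm (μ := volume.restrict (Ioi (0 : ℝ)))
    (F := fun p y ↦ T p y) (fun p ↦ integrableOn_T p) summable_norm_T
  have heq : ∫ y in Ioi (0 : ℝ), (∑' p : ℕ × ℕ, T p y) =
      ∫ y in Ioi (0 : ℝ), Gf y * ∫ v in Ioi (((N : ℝ) * y)⁻¹), Gf v :=
    setIntegral_congr_fun measurableSet_Ioi fun y hy ↦ (hasSum_T hy).tsum_eq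
  rw [heq] at hmain
  -- identify the terms: the summand is `4π² ∫ T p`
  have hterm : ∀ p : ℕ × ℕ, GL2Family.heckeLambda f p.1 * GL2Family.heckeLambda f p.2 *
        ((((p.1 : ℝ) * p.2) ^ (-(1 / 2 : ℝ)) : ℝ) : ℂ) *
        ((logCutoffW k k (Real.log (qhat N / p.1)) (Real.log (qhat N / p.2))
          ((p.1 : ℝ) * p.2 / qhat N ^ 2) : ℝ) : ℂ) =
      4 * (π : ℂ) ^ 2 * ∫ y in Ioi (0 : ℝ), T p y := by
    rintro ⟨n₁, n₂⟩
    rcases Nat.eq_zero_or_pos n₁ with rfl | h₁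
    · simp [T_fst_zero, heckeLambda_zero]
    rcases Nat.eq_zero_or_pos n₂ with rfl | h₂
    · simp [T_snd_zero, heckeLambda_zero]
    have hn₁ : (0 : ℝ) < n₁ := by exact_mod_cast h₁
    have hn₂ : (0 : ℝ) < n₂ := by exact_mod_cast h₂
    simp only
    rw [integral_T h₁.ne' h₂.ne', Bettin2017.heckeLambda_weight_two, Bettin2017.heckeLambda_weight_two]
    have hpow : (n₁ : ℝ) ^ (-(1 / 2 : ℝ)) * (n₂ : ℝ) ^ (-(1 / 2 : ℝ)) * ((n₁ : ℝ) * n₂) ^ (-(1 / 2 : ℝ)) =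
        1 / ((n₁ : ℝ) * n₂) := by
      rw [← Real.mul_rpow hn₁.le hn₂.le, ← Real.rpow_add (mul_pos hn₁ hn₂),
        show (-(1 / 2 : ℝ)) + -(1 / 2) = -1 by norm_num, Real.rpow_neg_one, one_div]
    have hpowC : (((n₁ : ℝ) ^ (-(1 / 2 : ℝ)) : ℝ) : ℂ) * (((n₂ : ℝ) ^ (-(1 / 2 : ℝ)) : ℝ) : ℂ) *
        ((((n₁ : ℝ) * n₂) ^ (-(1 / 2 : ℝ)) : ℝ) : ℂ) = 1 / ((n₁ : ℂ) * n₂) := by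
      have h := congrArg (fun x : ℝ ↦ (x : ℂ)) hpow
      push_cast at h
      exact h
    have hπ : (π : ℂ) ≠ 0 := by exact_mod_cast Real.pi_pos.ne'
    have hn₁' : (n₁ : ℂ) ≠ 0 := by exact_mod_cast h₁.ne'
    have hn₂' : (n₂ : ℂ) ≠ 0 := by exact_mod_cast h₂.ne'
    set W : ℝ := logCutoffW k k (Real.log (qhat N / n₁)) (Real.log (qhat N / n₂)) ((n₁ : ℝ) * n₂ / qhat N ^ 2)
      with hW
    push_cast
    calc cuspCoeff f n₁ * (((n₁ : ℝ) ^ (-(1 / 2 : ℝ)) : ℝ) : ℂ) *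
          (cuspCoeff f n₂ * (((n₂ : ℝ) ^ (-(1 / 2 : ℝ)) : ℝ) : ℂ)) *
          ((((n₁ : ℝ) * n₂) ^ (-(1 / 2 : ℝ)) : ℝ) : ℂ) * (W : ℂ)
        = cuspCoeff f n₁ * cuspCoeff f n₂ * (W : ℂ) *
          ((((n₁ : ℝ) ^ (-(1 / 2 : ℝ)) : ℝ) : ℂ) * (((n₂ : ℝ) ^ (-(1 / 2 : ℝ)) : ℝ) : ℂ) *
            ((((n₁ : ℝ) * n₂) ^ (-(1 / 2 : ℝ)) : ℝ) : ℂ)) := by ring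
      _ = cuspCoeff f n₁ * cuspCoeff f n₂ * (W : ℂ) * (1 / ((n₁ : ℂ) * n₂)) := by rw [hpowC]
      _ = _ := by field_simp; norm_num
  have hfun : (fun p : ℕ × ℕ ↦ GL2Family.heckeLambda f p.1 * GL2Family.heckeLambda f p.2 *
        ((((p.1 : ℝ) * p.2) ^ (-(1 / 2 : ℝ)) : ℝ) : ℂ) *
        ((logCutoffW k k (Real.log (qhat N / p.1)) (Real.log (qhat N / p.2))
          ((p.1 : ℝ) * p.2 / qhat N ^ 2) : ℝ) : ℂ)) =
      fun p ↦ 4 * (π : ℂ) ^ 2 * ∫ y in Ioi (0 : ℝ), T p y := funext hterm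
  rw [hfun]
  simp only [hGf, hw] at hmain
  exact hmain.mul_left _

/-- Stub **T4** of the fact skeleton `log-fricke-split` (crux workfile
`Cruxes/BeyondDiagonalBeatsQuarter/Lines/log_fricke_split.lean` on stmt-Parity-20343), in its registered
quantifier shape. [cite: KowalskiMichelVanderKam2000, (21)–(22) p. 12] -/
theorem hasSum_logCutoffW_all :
    ∀ (N : ℕ) [NeZero N] (f : CuspForm (Gamma0 N) 2) (k : ℕ),
      HasSum (fun n : ℕ × ℕ ↦ GL2Family.heckeLambda f n.1 * GL2Family.heckeLambda f n.2 *
          ((((n.1 : ℝ) * n.2) ^ (-(1 / 2 : ℝ)) : ℝ) : ℂ) *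
          ((KMV2000.logCutoffW k k (Real.log (KMV2000.qhat N / n.1)) (Real.log (KMV2000.qhat N / n.2))
            ((n.1 : ℝ) * n.2 / KMV2000.qhat N ^ 2) : ℝ) : ℂ))
        (4 * (π : ℂ) ^ 2 *
          ∫ y in Ioi (0 : ℝ), (f (UpperHalfPlane.ofComplex (Complex.I * y)) *
              (((Real.log (Real.sqrt N * y)) ^ k : ℝ) : ℂ)) *
            ∫ v in Ioi (((N : ℝ) * y)⁻¹), f (UpperHalfPlane.ofComplex (Complex.I * v)) *
              (((Real.log (Real.sqrt N * v)) ^ k : ℝ) : ℂ)) :=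
  fun _ _ f k ↦ hasSum_logCutoffW_afe f k

end Literature.NumberTheory.LFunctions.KMV2000

end
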